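import Summits.QuantumFields.BalabanUV.T4Continuum.Support.NE7K1LinConjW
import Summits.QuantumFields.BalabanUV.T4Continuum.Support.NE7K1LinTwoRunKit

/-!
# NE7K1LinSchurHarmonicExt — row NE7 (node U5), candidate route HOM, path H1L, cell K1-lin(s): (π6) for the SCHUR member, algebra —
# harmonic extensions, `conjW` COMMUTES WITH THE SCHUR COMPLEMENT, and the identity
# `err_{S}(z,u) = err_{H}(Ez, E_ρu)`: the bilinear conjugation error of `S(H) = A − BD⁻¹C` IS that of `H` between the harmonic
# extension of `z` and the CONJUGATED-harmonic extension of `u`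

Lineage `b2b-balaban-t4-ne7-p2` (CRUX PROVER NE7 #2), generation 64; lens 1's (π6) hint «S(e^{ρ}He^{−ρ}) = e^{ρ_c}S(H)e^{−ρ_c} for
block-diagonal weights, i.e. it IS the conjugation error of P₁ = S(H_B)» made precise.  [folklore], real matrices on coarse ⊕ fine:
* `schur H = H₁₁ − H₁₂H₂₂⁻¹H₂₁`, `hext H z = (z, −H₂₂⁻¹H₂₁z)` (the `H`-harmonic extension); `mulVec_hext`: `H(hext H z) = (schur H z, 0)`
  (`H₂₂` invertible); `dot_hext`: `⟨w, H(hext H z)⟩ = ⟨w_c, schur H z⟩`; `energy_hext`: `⟨Ez, HEz⟩ = ⟨z, schur H z⟩`; `schur_isSymm`.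
* `toBlocks_conjW₁₁ ∕ ₂₂` and the two-weight off-diagonal blocks; **`schur_conjW`**: `schur (conjW ρ H) = conjW (ρ∘inl) (schur H)`.
* **`bilin_err_schur_eq`**: for `H` symmetric with `H₂₂`, `(conjW ρ H)₂₂` invertible and all `z, u`,
  `⟨z,(conjW ρ_c (schur H))u⟩ − ⟨z,(schur H)u⟩ = ⟨hext H z, (conjW ρ H)(hext (conjW ρ H) u)⟩ − ⟨hext H z, H (hext (conjW ρ H) u)⟩`.

HONEST FRAMING: [folklore]; nothing printed asserted; no `sorry`.  FIXED FINITE T⁴, rung (B)+1; NE7 NOT PRINTED ∕ NOT PROVED; spine 0∕9;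
NOT infinite volume, NOT mass gap, NOT Clay.  HONEST DEPENDENCY: continuum YM on T⁴ ⇐ BetaPertH ∧ nine spine estimates (0/9 proved);
BetaPertH ⇐ (D1) ∧ (D4) ∧ CAP+tail; G-an2-4 gates asym, D1 and NE2/3/4.
-/

noncomputable section

open Finset Matrix

namespace Summit.QuantumFields.BalabanUV.T4Continuum.NE7K1LinSchurHarmonicExt

open NE7K1LinConjW NE7K1LinSchurLineDerivRel

variable {ιc ιf : Type*} [Fintype ιc] [Fintype ιf] [DecidableEq ιc] [DecidableEq ιf]

/-- the Schur complement of the fine block: `schur H = H₁₁ − H₁₂H₂₂⁻¹H₂₁`. [folklore] -/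
def schur (H : Matrix (ιc ⊕ ιf) (ιc ⊕ ιf) ℝ) : Matrix ιc ιc ℝ :=
  H.toBlocks₁₁ - H.toBlocks₁₂ * (H.toBlocks₂₂)⁻¹ * H.toBlocks₂₁

/-- the `H`-harmonic extension of a coarse vector: `hext H z = (z, −H₂₂⁻¹H₂₁z)`. [folklore] -/
def hext (H : Matrix (ιc ⊕ ιf) (ιc ⊕ ιf) ℝ) (z : ιc → ℝ) : ιc ⊕ ιf → ℝ :=
  Sum.elim z (-((H.toBlocks₂₂)⁻¹.mulVec (H.toBlocks₂₁.mulVec z)))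

omit [DecidableEq ιc] in
/-- block form of harmonicity: `[[A,B],[C,D]](z, −D⁻¹Cz) = ((A − BD⁻¹C)z, 0)`. [folklore] -/
theorem fromBlocks_mulVec_hext (A : Matrix ιc ιc ℝ) (B : Matrix ιc ιf ℝ) (C : Matrix ιf ιc ℝ) (D : Matrix ιf ιf ℝ)
    (hD : IsUnit D.det) (z : ιc → ℝ) :
    (fromBlocks A B C D).mulVec (Sum.elim z (-(D⁻¹.mulVec (C.mulVec z)))) = Sum.elim ((A - B * D⁻¹ * C).mulVec z) 0 := by
  rw [fromBlocks_mulVec, Sum.elim_comp_inl, Sum.elim_comp_inr]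
  congr 1
  · rw [mulVec_neg, sub_mulVec, ← mulVec_mulVec, ← mulVec_mulVec, sub_eq_add_neg]
  · rw [mulVec_neg, mulVec_mulVec, mul_nonsing_inv _ hD, one_mulVec, add_neg_cancel]

omit [DecidableEq ιc] in
/-- **HARMONICITY**: `H(hext H z) = (schur H z, 0)` (`H₂₂` invertible). [folklore] -/
theorem mulVec_hext (H : Matrix (ιc ⊕ ιf) (ιc ⊕ ιf) ℝ) (hD : IsUnit (H.toBlocks₂₂).det) (z : ιc → ℝ) :
    H.mulVec (hext H z) = Sum.elim ((schur H).mulVec z) 0 := by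
  have h := fromBlocks_mulVec_hext H.toBlocks₁₁ H.toBlocks₁₂ H.toBlocks₂₁ H.toBlocks₂₂ hD z
  rw [fromBlocks_toBlocks] at h
  exact h

omit [DecidableEq ιc] in
/-- `⟨w, H(hext H z)⟩ = ⟨w_c, schur H z⟩`. [folklore] -/
theorem dot_hext (H : Matrix (ιc ⊕ ιf) (ιc ⊕ ιf) ℝ) (hD : IsUnit (H.toBlocks₂₂).det) (w : ιc ⊕ ιf → ℝ) (z : ιc → ℝ) :
    w ⬝ᵥ H.mulVec (hext H z) = (w ∘ Sum.inl) ⬝ᵥ (schur H).mulVec z := by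
  rw [mulVec_hext H hD z]
  conv_lhs => rw [show w = Sum.elim (w ∘ Sum.inl) (w ∘ Sum.inr) from (Sum.elim_comp_inl_inr w).symm]
  rw [sumElim_dotProduct_sumElim, dotProduct_zero, add_zero]

omit [DecidableEq ιc] in
/-- `⟨hext H z, H(hext H z)⟩ = ⟨z, schur H z⟩`. [folklore] -/
theorem energy_hext (H : Matrix (ιc ⊕ ιf) (ιc ⊕ ιf) ℝ) (hD : IsUnit (H.toBlocks₂₂).det) (z : ιc → ℝ) :
    hext H z ⬝ᵥ H.mulVec (hext H z) = z ⬝ᵥ (schur H).mulVec z := by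
  rw [dot_hext H hD, hext, Sum.elim_comp_inl]

omit [DecidableEq ιc] in
/-- the squared norm of the harmonic extension: `‖hext H z‖² = ‖z‖² + ‖H₂₂⁻¹H₂₁z‖²`. [folklore] -/
theorem dot_hext_self (H : Matrix (ιc ⊕ ιf) (ιc ⊕ ιf) ℝ) (z : ιc → ℝ) :
    hext H z ⬝ᵥ hext H z = z ⬝ᵥ z + (H.toBlocks₂₂)⁻¹.mulVec (H.toBlocks₂₁.mulVec z) ⬝ᵥ
      (H.toBlocks₂₂)⁻¹.mulVec (H.toBlocks₂₁.mulVec z) := by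
  rw [hext, sumElim_dotProduct_sumElim, neg_dotProduct, dotProduct_neg, neg_neg]

omit [Fintype ιc] [DecidableEq ιc] in
/-- the Schur complement of a symmetric matrix is symmetric. [folklore] -/
theorem schur_isSymm (H : Matrix (ιc ⊕ ιf) (ιc ⊕ ιf) ℝ) (hH : H.IsSymm) : (schur H).IsSymm := by
  have hblocks := (Matrix.isSymm_fromBlocks_iff.1 (by rw [fromBlocks_toBlocks H]; exact hH))
  obtain ⟨hA, hBC, hCB, hD⟩ := hblocks
  unfold Matrix.IsSymm at hA hD ⊢
  rw [schur, transpose_sub, transpose_mul, transpose_mul, transpose_nonsing_inv, hA, hD, hBC, hCB, Matrix.mul_assoc]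

/-! ### conjugation and blocks -/

/-- the two-weight conjugation of a rectangular block: `(e^{θ_j − θ′_k}M_{jk})`. [folklore] -/
def conjW₂ {α β : Type*} (θ : α → ℝ) (θ' : β → ℝ) (M : Matrix α β ℝ) : Matrix α β ℝ :=
  Matrix.of fun j k => Real.exp (θ j - θ' k) * M j k

omit [Fintype ιc] [Fintype ιf] [DecidableEq ιc] [DecidableEq ιf] in
/-- blocks of the conjugated matrix. [folklore] -/
theorem toBlocks_conjW (ρ : ιc ⊕ ιf → ℝ) (H : Matrix (ιc ⊕ ιf) (ιc ⊕ ιf) ℝ) :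
    (conjW ρ H).toBlocks₁₁ = conjW (ρ ∘ Sum.inl) H.toBlocks₁₁ ∧
      (conjW ρ H).toBlocks₂₂ = conjW (ρ ∘ Sum.inr) H.toBlocks₂₂ ∧
        (conjW ρ H).toBlocks₁₂ = conjW₂ (ρ ∘ Sum.inl) (ρ ∘ Sum.inr) H.toBlocks₁₂ ∧
          (conjW ρ H).toBlocks₂₁ = conjW₂ (ρ ∘ Sum.inr) (ρ ∘ Sum.inl) H.toBlocks₂₁ := by
  refine ⟨?_, ?_, ?_, ?_⟩ <;> ext j k <;> rfl

omit [Fintype ιc] [DecidableEq ιc] [DecidableEq ιf] in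
/-- the conjugated product `B_ρ·conjW(D)·C_ρ` telescopes to `conjW ρ_c (B·D·C)`. [folklore] -/
theorem conjW₂_mul_conjW_mul_conjW₂ (θc : ιc → ℝ) (θf : ιf → ℝ) (B : Matrix ιc ιf ℝ) (M : Matrix ιf ιf ℝ)
    (C : Matrix ιf ιc ℝ) :
    conjW₂ θc θf B * conjW θf M * conjW₂ θf θc C = conjW θc (B * M * C) := by
  ext j l
  simp only [Matrix.mul_apply, conjW₂, conjW_apply, Matrix.of_apply, Finset.sum_mul, Finset.mul_sum]
  refine Finset.sum_congr rfl fun m _ => Finset.sum_congr rfl fun k _ => ?_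
  have : Real.exp (θc j - θc l) = Real.exp (θc j - θf k) * Real.exp (θf k - θf m) * Real.exp (θf m - θc l) := by
    rw [← Real.exp_add, ← Real.exp_add]; congr 1; ring
  rw [this]; ring

omit [Fintype ιc] [DecidableEq ιc] in
/-- **`conjW` COMMUTES WITH THE SCHUR COMPLEMENT**: `schur (conjW ρ H) = conjW (ρ∘inl) (schur H)` (`H₂₂` invertible).
[folklore] -/
theorem schur_conjW (ρ : ιc ⊕ ιf → ℝ) (H : Matrix (ιc ⊕ ιf) (ιc ⊕ ιf) ℝ) (hD : IsUnit (H.toBlocks₂₂).det) :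
    schur (conjW ρ H) = conjW (ρ ∘ Sum.inl) (schur H) := by
  obtain ⟨h11, h22, h12, h21⟩ := toBlocks_conjW ρ H
  rw [schur, schur, h11, h22, h12, h21, ← conjW_inv _ _ hD, conjW₂_mul_conjW_mul_conjW₂, conjW_sub]

/-! ### the identity for the bilinear conjugation error of the Schur complement -/

omit [DecidableEq ιc] in
/-- **`err_S(z,u) = err_H(Ez, E_ρu)`**: for `H` symmetric with `H₂₂` and `(conjW ρ H)₂₂` invertible, the bilinear conjugation error
of `schur H` at `ρ∘inl` between `z` and `u` equals that of `H` at `ρ` between the `H`-harmonic extension of `z` and the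
`(conjW ρ H)`-harmonic extension of `u`. [folklore] -/
theorem bilin_err_schur_eq (ρ : ιc ⊕ ιf → ℝ) (H : Matrix (ιc ⊕ ιf) (ιc ⊕ ιf) ℝ) (hH : H.IsSymm)
    (hD : IsUnit (H.toBlocks₂₂).det) (hDρ : IsUnit ((conjW ρ H).toBlocks₂₂).det) (z u : ιc → ℝ) :
    z ⬝ᵥ (conjW (ρ ∘ Sum.inl) (schur H)).mulVec u - z ⬝ᵥ (schur H).mulVec u =
      hext H z ⬝ᵥ (conjW ρ H).mulVec (hext (conjW ρ H) u) - hext H z ⬝ᵥ H.mulVec (hext (conjW ρ H) u) := by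
  -- first terms: `⟨Ez, H_ρ E_ρ u⟩ = ⟨z, schur(H_ρ) u⟩ = ⟨z, conjW ρ_c (schur H) u⟩`
  have h1 : hext H z ⬝ᵥ (conjW ρ H).mulVec (hext (conjW ρ H) u) = z ⬝ᵥ (conjW (ρ ∘ Sum.inl) (schur H)).mulVec u := by
    rw [dot_hext (conjW ρ H) hDρ, hext, Sum.elim_comp_inl, schur_conjW ρ H hD]
  -- second terms: `⟨Ez, H E_ρu⟩ = ⟨H Ez, E_ρu⟩ = ⟨(Sz,0), (u,·)⟩ = ⟨Sz, u⟩ = ⟨z, Su⟩`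
  have h2 : hext H z ⬝ᵥ H.mulVec (hext (conjW ρ H) u) = z ⬝ᵥ (schur H).mulVec u := by
    rw [dot_mulVec_comm_of_isSymm H hH, dot_hext H hD, hext, Sum.elim_comp_inl,
      dot_mulVec_comm_of_isSymm (schur H) (schur_isSymm H hH)]
  rw [h1, h2]

end Summit.QuantumFields.BalabanUV.T4Continuum.NE7K1LinSchurHarmonicExt
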